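import Literature.MathematicalPhysics.QuantumFieldTheory.Balaban1983to89.B8Eq191FlatLettersRDOfRealRec
import Literature.MathematicalPhysics.QuantumFieldTheory.Balaban1983to89.B8Eq191FlatLettersRDTau

/-!
# `Balaban1983to89.B8Eq191FlatLettersRDTauRec` — RECORD TWIN of `B8Eq191FlatLettersRDTau` ([Balaban1985RegularSpaces] Sect. D–E pp. 91–96 with
# [Balaban1985BackgroundPropagators] Thms 3.1–3.2 p. 397 and (3.23)–(3.25) p. 394 at background `1`: the complete [4]-letters block of the Prop-5 JOIN at `U₀ = 1` on a
# finite Dirichlet region — `G′(1)`, `Δ`, `Q`, `Qᵀ`, `𝔄`, `C(1)`, `H′(1)` — from three REAL inequality families on the explicit matrices, PLUS the letters' `τ`-compatibility for a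
# continuous ℂ-linear functional `τ` (joint J-SU, [Balaban1985Averaging] p. 20 «a Lie subgroup G of a unitary group U(N)»)) FOR THE SYMMETRISED CENTRED block averaging (0.4)
# of [Balaban1987RG1] (stencils `zdBlockingZ ∕ bgTZ ∕ QTZ`, block labels `flmZ`, odd `L`)

statement-level skeleton of published theorems with citation tags; proofs where landed; nothing here is a claim about the Yang–Mills mass gap

T. Bałaban, *Spaces of regular gauge field configurations on a lattice and gauge fixing conditions*, Commun. Math. Phys. **99** (1985) 75–102 `[Balaban1985RegularSpaces]`
("[6]"): (1.91)–(1.92) p. 91, (1.95)–(1.98) p. 92, (1.101) p. 93, p. 96 («Q′H′ = I»), Prop. 5 p. 94, (1.17) p. 78; T. Bałaban, *Propagators for lattice gauge theories in a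
background field*, Commun. Math. Phys. **99** (1985) 389–434 `[Balaban1985BackgroundPropagators]` ("[4]"): Thm 3.1 p. 397, Thm 3.2 p. 398, (3.23)–(3.25) p. 394 («⊗ identity»);
T. Bałaban, *Propagators and renormalization transformations for lattice gauge theories. II*, Commun. Math. Phys. **96** (1984) 223–250 `[Balaban1984PropagatorsII]`: p. 235;
T. Bałaban, *Averaging operations for lattice gauge theories*, Commun. Math. Phys. **98** (1985) 17–51 `[Balaban1985Averaging]` ("[3]"): p. 20; T. Bałaban, *Renormalization
group approach to lattice gauge field theories. I*, Commun. Math. Phys. **109** (1987) 249–301 `[Balaban1987RG1]` ("[I]"): (0.3)–(0.4) pp. 252–253.  STATUS: published, refereed.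

CITATION HEADER (lean-in-tree rule).  Cell `pub-ymgap`, «N05-REC» R8 = the `G`∕τ-EDITION OF RECORD (desk `R6-PLAN.md` §6 (B)), file T7 — LEAD PEN dag-n05-e g40.  WHAT IS
REPRODUCED = ★★ `flatLettersZRD_of_real_tau` — ✓`B8Eq191FlatLettersRDTau.flatLettersRD_of_real_tau` (this seat g33, engine) VERBATIM under the record token map of
`B8Eq191FlatLettersRDOfRealRec` (`zdBlocking ∕ bgT ∕ QT ↦ zdBlockingZ ∕ bgTZ ∕ QTZ`, `blockMap (Lʲ) ↦ flmZ L j`, `(hL : 1 ≤ L) ↦ (hLo : Odd L)`; inputs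
`B8Eq191FlatLettersExplicitRec.exists_flatLettersZ_dirichlet_explicit`, `B8Eq191FlatStencilsRec.{QprimeIterZ_flat_eq_sum_of_supp, QprimeIter_bgTZ_one}`,
`B8Eq138LandauFlatOrthogonalRec.QTZ_flat_apply`, `B8Eq191FlatLettersDirichletRec.tower_sum_eq_bm`; structure-free engine inputs `kernel_comp`, `B8Eq191FlatBoundsTransfer.*` BY NAME):
`B8Eq191FlatLettersRDOfRealRec.flatLettersZRD_of_real`'s sixteen binders PLUS the three `τ`-clauses `hHτ hGτ hRτ` (real kernels ⊗ id commute with a continuous ℂ-linear `τ`;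
`apply_sum_real_smul_eq_zero`).  THEOREM NAME: `flatLettersZRD_of_real_tau` (the engine's `apply_sum_real_smul_eq_zero` is structure-free and consumed BY NAME).  Kind «kernel-checked proof», theorems
only: no `def`, no `… : Prop` fact, no `instance`, no `notation`, no existing module modified.  `--supports stmt-QuantumFields-20541` (K0⁷-keyed, COUNT-NEUTRAL).

HONEST SCOPE.  Bookkeeping: the three real inequality families (1.92)∕(1.98)∕(1.101) remain displayed hypotheses (discharged elsewhere for the record by
`B8Real123FlatTranslateRec` ∕ `B8Real123CubeMemberRec`); NO new estimate; the record crown stays CONDITIONAL ×2 on the named Cov facts; `HThm4Rec` UNDISCHARGED; N05 ∕ N07 NOT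
discharged; one finite `𝕋⁴` programme at fixed `ε`, Bałaban AS PRINTED; nothing continuum ∕ ℝ⁴ ∕ OS ∕ mass-gap ∕ Clay.  No `sorry`, no `def`.
-/

noncomputable section

namespace Literature.MathematicalPhysics.QuantumFieldTheory.Balaban1983to89.B8Eq191FlatLettersRDTauRec


open Finset
open scoped Matrix
open B7Prop1Explicit (e)
open B7Eq78Linearization (QprimeIter)
open B7SectEFLinearisationRec (zdBlockingZ bgTZ)
open B8Ineq132 (covDerivFwd)
open B8Eq119TwistedAxialRec (flmZ)
open B8Eq138LandauZd (covLap)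
open B8Eq138LandauZdRec (QTZ)
open B8Eq138LandauFlatOrthogonalRec (QTZ_flat_apply)
open B8Eq140Level (SideTouches)
open B8Eq1117Concrete (XSpace)
open B8Prop5ContractionKLevel (Bd2)
open B8LambdaSpaceKLevel (wt)
open B8Eq191FlatStencilsRec (QprimeIterZ_flat_eq_sum_of_supp QprimeIter_bgTZ_one)
open B8Eq191FlatLettersDirichlet (kernel_comp)
open B8Eq191FlatLettersDirichletRec (tower_sum_eq_bm)
open B8Eq191FlatLettersExplicitRec (exists_flatLettersZ_dirichlet_explicit)
open B8Eq191FlatBoundsTransfer (hG_flat_of_real hH_flat_of_real hRbd_flat_of_real)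
open B8Eq191FlatLettersRDTau (apply_sum_real_smul_eq_zero)

-- `Site` alone could resolve to the torus sites of `Setup.lean`; re-export the `ℤ^d` sites of `B7Prop1Explicit`.
export B7Prop1Explicit (Site)

variable {d : ℕ}

section Letters

variable {𝔸 : Type*} [CStarAlgebra 𝔸]

open Classical in
/-- ★★ (RECORD TWIN of `B8Eq191FlatLettersRDTau.flatLettersRD_of_real_tau`.) **THE COMPLETE [4]-LETTERS BLOCK OF THE JOIN AT `U₀ = 1` ON A FINITE DIRICHLET REGION FOR THE RECORD's
AVERAGING, FROM THREE REAL INEQUALITY FAMILIES, WITH THE LETTERS' `τ`-COMPATIBILITY.**  `B8Eq191FlatLettersRDOfRealRec.flatLettersZRD_of_real` VERBATIM (centred blocking `zdBlockingZ ∕ bgTZ ∕ QTZ`, labels `flmZ`, odd `L`) (data, the three real families `realG realH realR`, the sixteen binders of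
`B8SockHFPRD.sockHFP_body_of_join_RD` at `U₀ := 1`) PLUS, for a continuous ℂ-linear functional `τ : 𝔸 → ℂ`: `H′` maps `τ`-free tower families to `τ`-free
configurations, `G′` maps configurations `τ`-free on the `Ω_j` to `τ`-free configurations, and `R = 1 − G′QᵀCQG′` likewise on the `Ω_j` — because the letters are the
real kernels `T⁻¹`, `T⁻¹T⁻¹Qᵀ(QT⁻¹T⁻¹Qᵀ)⁻¹`, `T⁻¹Qᵀ(QT⁻¹T⁻¹Qᵀ)⁻¹QT⁻¹` ⊗ id (supported on `Ω₀`), and `τ` commutes with finite sums of real scalar multiples.  These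
are the binders `hHτ hGτ hRτ` of the record's trace-free JOIN (`B8SockHFPTraceFreeRec.sockHFP_body_of_join_RD_traceFree`; [Balaban1985Averaging] p. 20, `G = SU(N)`: `λ` trace-free ⇒
`e^{iλ} ∈ SU(N)`).
[cite: Balaban1985RegularSpaces, (1.91)–(1.92) p.91, (1.95)–(1.98) p.92, (1.101) p.93, p.96, Prop. 5 p.94, p.76; Balaban1985BackgroundPropagators, Thms 3.1–3.2 p.397, (3.23)–(3.25) p.394; Balaban1984PropagatorsII, p.235] -/
theorem flatLettersZRD_of_real_tau (τ : 𝔸 →L[ℂ] ℂ) (hd : 0 < d) {η : ℝ} (hη : 0 < η) {L : ℕ} (hLo : Odd L) (n : ℕ) (Ω : ℕ → Set (Site d))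
    (hΩ0 : ∀ j, j ≤ n → Ω j ⊆ Ω 0) (Λs : ℕ → Set (Site d)) (a : ℕ → ℝ) (ha : ∀ j, 0 ≤ a j)
    (S : Finset (Site d)) (hS : ∀ w, w ∈ S ↔ w ∈ Ω 0)
    (hmeet : ∀ j, j ≤ n → ∀ y ∈ Λs j, ∃ z ∈ Ω 0, flmZ L j z = y)
    (hdisj : ∀ j, j ≤ n → ∀ j', j' ≤ n → ∀ y ∈ Λs j, ∀ y' ∈ Λs j', ∀ z ∈ Ω 0,
      flmZ L j z = y → flmZ L j' z = y' → j = j' ∧ y = y')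
    (B : Finset (ℕ × Site d)) (hB : ∀ p, p ∈ B ↔ p.1 ≤ n ∧ p.2 ∈ Λs p.1)
    (K : Site d → Site d → ℝ)
    (hK : ∀ x z, K x z = ((η ^ 2)⁻¹ * ∑ μ : Fin d, ((2 : ℝ) * (if z = x then (1 : ℝ) else 0) - (if z = x + e μ then (1 : ℝ) else 0)
      - (if z = x - e μ then (1 : ℝ) else 0))) +
      (∑ j ∈ Finset.range (n + 1), (if flmZ L j x ∈ Λs j ∧ flmZ L j z = flmZ L j x then
        a j * ((((L : ℝ) ^ d)⁻¹) ^ j) ^ 2 else 0)))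
    (T : Matrix ↥S ↥S ℝ) (hT : T = Matrix.of fun x z : ↥S => K x.1 z.1)
    (Q : Matrix ↥B ↥S ℝ)
    (hQ : Q = Matrix.of fun (p : ↥B) (z : ↥S) => if flmZ L p.1.1 z.1 = p.1.2 then (((L : ℝ) ^ d)⁻¹) ^ p.1.1 else 0)
    {BG B₀'H B₂' BR : ℝ}
    -- (1.101) for `T⁻¹`, real lattice functions
    (realG : ∀ (ρ : ↥S → ℝ) (r : ℝ), 0 ≤ r → (∀ j, j ≤ n → ∀ z : ↥S, z.1 ∈ Ω j → wt L η j ^ 2 * |ρ z| ≤ r) →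
      ∀ φ : Site d → ℝ, (∀ x, x ∉ Ω 0 → φ x = 0) → (∀ w : ↥S, φ w.1 = ∑ z : ↥S, T⁻¹ w z * ρ z) →
      (∀ x, |φ x| ≤ BG * r) ∧
      ∀ j, j ≤ n → ∀ p ∈ {b : Site d × Fin d | SideTouches (Ω j) b.1 b.2},
        wt L η j * |η⁻¹ * (φ (p.1 + e p.2) - φ p.1)| ≤ BG * r)
    -- (1.92) and the p. 93 `Δ`-entry for `T⁻¹(T⁻¹Qᵀ)(QT⁻¹T⁻¹Qᵀ)⁻¹`, real `X`
    (realH : ∀ (X : ↥B → ℝ) (s : ℝ), 0 ≤ s → (∀ p', |X p'| ≤ s) →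
      ∀ φ : Site d → ℝ, (∀ x, x ∉ Ω 0 → φ x = 0) →
      (∀ w : ↥S, φ w.1 = ∑ p' : ↥B, (T⁻¹ * (T⁻¹ * Qᵀ) * (Q * T⁻¹ * T⁻¹ * Qᵀ)⁻¹) w p' * X p') →
      (∀ x, |φ x| ≤ B₀'H * s) ∧
      (∀ j, j ≤ n → ∀ p ∈ {b : Site d × Fin d | SideTouches (Ω j) b.1 b.2},
        wt L η j * |η⁻¹ * (φ (p.1 + e p.2) - φ p.1)| ≤ B₀'H * s) ∧
      (∀ j, j ≤ n → ∀ x ∈ Ω j,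
        wt L η j ^ 2 * |∑ μ : Fin d, (η ^ 2)⁻¹ * (2 * φ x - φ (x + e μ) - φ (x - e μ))| ≤ B₂' * s))
    -- (1.98) for `1 − T⁻¹Qᵀ(QT⁻¹T⁻¹Qᵀ)⁻¹QT⁻¹`, real lattice functions
    (realR : ∀ (ρ : ↥S → ℝ) (r : ℝ), 0 ≤ r → (∀ j, j ≤ n → ∀ z : ↥S, z.1 ∈ Ω j → wt L η j ^ 2 * |ρ z| ≤ r) →
      ∀ j, j ≤ n → ∀ w : ↥S, w.1 ∈ Ω j →
        wt L η j ^ 2 * |ρ w - ∑ z : ↥S, (T⁻¹ * (Qᵀ * ((Q * T⁻¹ * T⁻¹ * Qᵀ)⁻¹ * (Q * T⁻¹)))) w z * ρ z| ≤ BR * r) :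
    ∃ (g Δ : (Site d → 𝔸) →ₗ[ℂ] (Site d → 𝔸)) (q : (Site d → 𝔸) →ₗ[ℂ] (ℕ → Site d → 𝔸))
      (qs : (ℕ → Site d → 𝔸) →ₗ[ℂ] (Site d → 𝔸)) (Aw c : (ℕ → Site d → 𝔸) →ₗ[ℂ] (ℕ → Site d → 𝔸))
      (H' : XSpace d n 𝔸 →ₗ[ℂ] (Site d → 𝔸)),
      (∀ x, ∀ y ∈ Ω 0, (Δ (g x) + qs (Aw (q (g x)))) y = x y) ∧ (∀ f, q (g (g (qs (c (q f))))) = q f) ∧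
      (∀ (f : Site d → 𝔸), ∀ x ∈ Ω 0, Δ f x = covLap η (1 : Site d → Fin d → 𝔸ˣ) ((Ω 0).indicator f) x) ∧
      (∀ (μ : ℕ → Site d → 𝔸), ∀ x ∈ Ω 0, qs μ x = QTZ L n Λs (1 : Site d → Fin d → 𝔸ˣ) μ x) ∧
      (∀ (f : Site d → 𝔸) (j : ℕ), j ≤ n → ∀ y ∈ Λs j, q f j y = QprimeIter (zdBlockingZ d L) (bgTZ L (1 : Site d → Fin d → 𝔸ˣ)) j f y) ∧
      (∀ (X : XSpace d n 𝔸) (x : Site d), ‖H' X x‖ ≤ B₀'H * ‖X‖) ∧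
      (∀ j, j ≤ n → ∀ (X : XSpace d n 𝔸), ∀ p ∈ {b : Site d × Fin d | SideTouches (Ω j) b.1 b.2},
        wt L η j * ‖covDerivFwd η (1 : Site d → Fin d → 𝔸ˣ) p.2 (H' X) p.1‖ ≤ B₀'H * ‖X‖) ∧
      (∀ X : XSpace d n 𝔸, Bd2 L η n Ω (covLap η (1 : Site d → Fin d → 𝔸ˣ) (H' X)) (B₂' * ‖X‖)) ∧
      (∀ (X : XSpace d n 𝔸) (x : Site d), x ∉ Ω 0 → H' X x = 0) ∧
      (∀ X Y : XSpace d n 𝔸, (∀ p, Y p = -star (X p)) → ∀ x, H' Y x = -star (H' X x)) ∧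
      (∀ (Y : XSpace d n 𝔸) (j : ℕ) (hj : j ≤ n) (y : Site d), y ∈ Λs j →
        QprimeIter (zdBlockingZ d L) (bgTZ L (1 : Site d → Fin d → 𝔸ˣ)) j (H' Y) y = Y (⟨j, Nat.lt_succ_of_le hj⟩, y)) ∧
      (∀ (f : Site d → 𝔸) (r : ℝ), 0 ≤ r → Bd2 L η n Ω f r →
        (∀ x, ‖g f x‖ ≤ BG * r) ∧ ∀ j, j ≤ n → ∀ p ∈ {b : Site d × Fin d | SideTouches (Ω j) b.1 b.2},
          wt L η j * ‖covDerivFwd η (1 : Site d → Fin d → 𝔸ˣ) p.2 (g f) p.1‖ ≤ BG * r) ∧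
      (∀ (f : Site d → 𝔸) (x : Site d), x ∉ Ω 0 → g f x = 0) ∧
      (∀ f : Site d → 𝔸, (∀ j, j ≤ n → ∀ x ∈ Ω j, IsSelfAdjoint (f x)) → ∀ x, IsSelfAdjoint (g f x)) ∧
      (∀ (f : Site d → 𝔸) (r : ℝ), 0 ≤ r → Bd2 L η n Ω f r → Bd2 L η n Ω (f - g (qs (c (q (g f))))) (BR * r)) ∧
      (∀ f : Site d → 𝔸, (∀ j, j ≤ n → ∀ x ∈ Ω j, IsSelfAdjoint (f x)) →
        ∀ j, j ≤ n → ∀ x ∈ Ω j, IsSelfAdjoint ((f - g (qs (c (q (g f))))) x)) ∧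
      -- the letters' `τ`-compatibility (joint J-SU): `H′`, `G′`, `R = 1 − G′QᵀCQG′` map `τ`-free data to `τ`-free configurations
      (∀ X : XSpace d n 𝔸, (∀ p, τ (X p) = 0) → ∀ x, τ (H' X x) = 0) ∧
      (∀ f : Site d → 𝔸, (∀ j, j ≤ n → ∀ x ∈ Ω j, τ (f x) = 0) → ∀ x, τ (g f x) = 0) ∧
      (∀ f : Site d → 𝔸, (∀ j, j ≤ n → ∀ x ∈ Ω j, τ (f x) = 0) →
        ∀ j, j ≤ n → ∀ x ∈ Ω j, τ ((f - g (qs (c (q (g f))))) x) = 0) := by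
  -- the letters with the eleven laws and the four displayed kernels (g3's file 6)
  obtain ⟨g, Δ, q, qs, Aw, c, H', g_rightΩ, c_range, hΔ, hqs, hq, -, hHsupp, hHequiv, hQH, hGsupp, hGreal₀, hRreal₀, hgker, hcker,
    -, hHker⟩ := exists_flatLettersZ_dirichlet_explicit (𝔸 := 𝔸) hd hη.ne' hLo n Λs a ha (Ω 0) S hS hmeet hdisj B hB K hK T hT Q hQ
  -- §1 the composite kernel of `G′QᵀCQG′`: `T⁻¹·Qᵀ·M⁻¹·Q·T⁻¹`, `M = QT⁻¹T⁻¹Qᵀ`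
  have hg_supp : ∀ (f : Site d → 𝔸) (w : Site d), w ∉ S → g f w = 0 := fun f w hw => hGsupp f w (fun h => hw ((hS w).mpr h))
  have hq_mem : ∀ (u : Site d → 𝔸), (∀ w, w ∉ S → u w = 0) → ∀ p : ↥B, q u p.1.1 p.1.2 = ∑ z : ↥S, (Q p z) • u z.1 := by
    intro u hu p
    have hp := (hB p.1).mp p.2
    rw [hq u p.1.1 hp.1 p.1.2 hp.2, QprimeIter_bgTZ_one, QprimeIterZ_flat_eq_sum_of_supp L hLo S u hu p.1.1 p.1.2, ← Finset.sum_coe_sort S]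
    exact Finset.sum_congr rfl fun z _ => by rw [hQ, Matrix.of_apply]
  have hqg : ∀ (f : Site d → 𝔸) (p : ↥B), q (g f) p.1.1 p.1.2 = ∑ w : ↥S, ((Q * T⁻¹) p w) • f w.1 := by
    intro f p
    rw [hq_mem _ (hg_supp f) p, Finset.sum_congr rfl fun z _ => by rw [hgker f z]]
    exact kernel_comp Q T⁻¹ (fun w : ↥S => f w.1) p
  have hcqg : ∀ (f : Site d → 𝔸) (p : ↥B),
      c (q (g f)) p.1.1 p.1.2 = ∑ w : ↥S, (((Q * T⁻¹ * T⁻¹ * Qᵀ)⁻¹ * (Q * T⁻¹)) p w) • f w.1 := by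
    intro f p
    rw [hcker, Finset.sum_congr rfl fun p' _ => by rw [hqg f p']]
    exact kernel_comp (Q * T⁻¹ * T⁻¹ * Qᵀ)⁻¹ (Q * T⁻¹) (fun w : ↥S => f w.1) p
  have hqs_ker : ∀ (φ : ℕ → Site d → 𝔸) (z : ↥S), qs φ z.1 = ∑ p : ↥B, (Qᵀ z p) • φ p.1.1 p.1.2 := by
    intro φ z
    rw [hqs φ z.1 ((hS z.1).mp z.2), QTZ_flat_apply hLo, tower_sum_eq_bm L n Λs (flmZ L) B hB φ z.1, ← Finset.sum_coe_sort B]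
    exact Finset.sum_congr rfl fun p _ => by rw [Matrix.transpose_apply, hQ, Matrix.of_apply]
  have hqscqg : ∀ (f : Site d → 𝔸) (z : ↥S),
      qs (c (q (g f))) z.1 = ∑ w : ↥S, ((Qᵀ * ((Q * T⁻¹ * T⁻¹ * Qᵀ)⁻¹ * (Q * T⁻¹))) z w) • f w.1 := by
    intro f z
    rw [hqs_ker, Finset.sum_congr rfl fun p _ => by rw [hcqg f p]]
    exact kernel_comp Qᵀ ((Q * T⁻¹ * T⁻¹ * Qᵀ)⁻¹ * (Q * T⁻¹)) (fun w : ↥S => f w.1) z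
  have hR : ∀ (f : Site d → 𝔸) (w : ↥S),
      (fun f => g (qs (c (q (g f))))) f w.1 = ∑ z : ↥S, ((T⁻¹ * (Qᵀ * ((Q * T⁻¹ * T⁻¹ * Qᵀ)⁻¹ * (Q * T⁻¹)))) w z) • f z.1 := by
    intro f w
    show g (qs (c (q (g f)))) w.1 = _
    rw [hgker _ w, Finset.sum_congr rfl fun z _ => by rw [hqscqg f z]]
    exact kernel_comp T⁻¹ (Qᵀ * ((Q * T⁻¹ * T⁻¹ * Qᵀ)⁻¹ * (Q * T⁻¹))) (fun z : ↥S => f z.1) w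
  -- §2 the five bounds by the real-kernel ⊗ id transfer
  have hG := hG_flat_of_real L hη n Ω S hS g T⁻¹ hgker hGsupp realG
  obtain ⟨hH0, hH1, hH2⟩ := hH_flat_of_real L hη n Ω Λs S hS B hB H' (T⁻¹ * (T⁻¹ * Qᵀ) * (Q * T⁻¹ * T⁻¹ * Qᵀ)⁻¹) hHker hHsupp realH
  have hRbd := hRbd_flat_of_real (𝔸 := 𝔸) L n Ω hΩ0 S hS (fun f => g (qs (c (q (g f)))))
    (T⁻¹ * (Qᵀ * ((Q * T⁻¹ * T⁻¹ * Qᵀ)⁻¹ * (Q * T⁻¹)))) hR realR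
  refine ⟨g, Δ, q, qs, Aw, c, H', g_rightΩ, c_range, hΔ, hqs, hq, hH0, hH1, hH2, hHsupp, hHequiv, hQH, hG, hGsupp, ?_, ?_, ?_, ?_, ?_, ?_⟩
  · -- reality of `G′`
    intro f hf
    exact hGreal₀ f (fun x hx => hf 0 (Nat.zero_le _) x hx)
  · -- (1.98)
    intro f r hr hf
    exact hRbd f r hr hf
  · -- reality of `R = 1 − G′QᵀCQG′`
    intro f hf j hj x hx
    rw [Pi.sub_apply]
    exact (hf j hj x hx).sub (hRreal₀ f (fun y hy => hf 0 (Nat.zero_le _) y hy) x)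

  · -- `τ`-compatibility of `H′ = T⁻¹T⁻¹Qᵀ(QT⁻¹T⁻¹Qᵀ)⁻¹ ⊗ id`
    intro X hX x
    by_cases hx : x ∈ Ω 0
    · rw [show x = (⟨x, (hS x).mpr hx⟩ : ↥S).1 from rfl, hHker]
      exact apply_sum_real_smul_eq_zero τ _ _ _ fun p _ => hX _
    · rw [hHsupp X x hx, map_zero]
  · -- `τ`-compatibility of `G′ = T⁻¹ ⊗ id`
    intro f hf x
    by_cases hx : x ∈ Ω 0
    · rw [show x = (⟨x, (hS x).mpr hx⟩ : ↥S).1 from rfl, hgker]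
      exact apply_sum_real_smul_eq_zero τ _ _ _ fun z _ => hf 0 (Nat.zero_le _) z.1 ((hS z.1).mp z.2)
    · rw [hGsupp f x hx, map_zero]
  · -- `τ`-compatibility of `R = 1 − G′QᵀCQG′ = (1 − T⁻¹Qᵀ(QT⁻²Qᵀ)⁻¹QT⁻¹) ⊗ id`
    intro f hf j hj x hx
    have hx0 : x ∈ Ω 0 := hΩ0 j hj hx
    rw [Pi.sub_apply, map_sub, hf j hj x hx, zero_sub, neg_eq_zero, show x = (⟨x, (hS x).mpr hx0⟩ : ↥S).1 from rfl]
    have hRx := hR f ⟨x, (hS x).mpr hx0⟩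
    simp only at hRx
    rw [hRx]
    exact apply_sum_real_smul_eq_zero τ _ _ _ fun z _ => hf 0 (Nat.zero_le _) z.1 ((hS z.1).mp z.2)

end Letters

#print axioms flatLettersZRD_of_real_tau

end Literature.MathematicalPhysics.QuantumFieldTheory.Balaban1983to89.B8Eq191FlatLettersRDTauRec

end
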